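import Mathlib
import Literature.MathematicalPhysics.QuantumLattice.BalabanRG

/-!
# Route «BalabanUVNodes» (K4 «SpineRates»), node N15 = NE2, BACKGROUND LAYER — second hand, part 9: THE BLOCK RIEMANN SUM
# OF A DISCRETISED LIPSCHITZ KERNEL (the `U ≡ 1` INPUT of the background step for kernel operators, model form)

Cell `pub-ymgap`, seat `pub-ymgap-dag-n20-b` (g2; D-0062; `bears_on: R4∕N15`; `--supports stmt-QuantumFields-19351` as helper),
on the owner's cut [DAGN15B-G0-CUT-1] (pub-ymgap INBOX l.9571, seat `pub-ymgap-dag-n15-b`): record `pub-balaban/t4/T4-EST-U1a.md`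
§16 item S6 «first END-TO-END (N3) instance in MODEL form», cut down to the `U ≡ 1` input — binder (a) of
`BalabanUVNodesN15BackgroundStep.idef_background_propagator_majorant` — for DISCRETISED LIPSCHITZ KERNELS: by the owner's
`binderA_iff_kernel_bound` (file `BalabanUVNodesN15KernelDefect`), binder (a) for kernel operators is a pointwise bound on the
BLOCK-SUMMED fine kernel minus the coarse kernel.  THIS FILE proves that pointwise bound for kernels obtained by discretising one
Lipschitz function `k : ℝ^d → ℝ` at two commensurable spacings.  THEOREMS ONLY (no definition): the kernels are written out.

THE STATEMENT (any dimension `d`, sup norm on `ℝ^d = Fin d → ℝ`).  Let `k` satisfy `|k a − k b| ≤ Lip·‖a − b‖` (`Lip ≥ 0`), let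
`η′ ≥ 0` be the fine spacing, `M ≥ 1` the block size, `η = M·η′` the coarse spacing; fine kernel `K′(x′,u′) = η′^d·k(η′·(x′ − u′))`
on `ℤ^d` (`x′ − u′` cast to `ℝ^d` coordinatewise), coarse kernel `K(x,u) = η^d·k(η·(x − u))`.  Then for every fine site `x′` and
every coarse site `u` (`abs_blockSum_fineKernel_sub_coarseKernel_le`, `…_le_pow`):

  `|Σ_{u′ ∈ B(u)} K′(x′,u′) − K(⌊x′∕M⌋, u)| ≤ Lip·η^d·η′(M − 1) ≤ Lip·η^{d+1}`,

`B(u) = blockSites M u` the `M^d` fine sites of the block of `u`, `⌊x′∕M⌋ = blockMap M x′` (prelude `QuantumLattice.BalabanRG`).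
MECHANISM (a Riemann sum with the right total weight): `Σ_{u′ ∈ B(u)} η′^d = M^d η′^d = η^d` (`card_blockSites`), so the difference
is `Σ_{u′} η′^d·[k(η′(x′ − u′)) − k(η(⌊x′∕M⌋ − u))]`, and each fine argument differs from the coarse one by `η′·(r(x′) − r(u′))` with the
block remainders `r(·) = · − M⌊·∕M⌋ ∈ {0,…,M−1}^d` (`sub_mul_blockMap_mem`), sup norm `≤ η′(M − 1)` (`norm_fineArg_sub_coarseArg_le`).
In `d = 1` this is the owner's displayed case (`K′(x′,u′) = η′·k(η′(x′ − u′))`, constant `1 ≤ 3∕2`); the relative size against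
`sup|k|·η^d` is ONE rate factor `η·Lip∕sup|k|`, King's (4.1)–(4.4) mechanism in position space ([King1986] p. 664, as the owner's
memo `N15B-BACKGROUND-LAYER.md` §2 reads it); `abs_blockSum_operator_defect_le` is the operator form on finitely supported
coarse functions (`ℓ¹(f)` control), `…_le_dim_one` the owner's scalar `d = 1` display.  No decay is needed or claimed (the ρ = 0
model).

HONEST FRAMING.  [folklore] real analysis on `ℤ^d` (model level: discretised continuum kernels); nothing of [B9] ∕ King asserted;
NE2⁺ is NOT PRINTED and NOT proved here; count-neutral (typed 28∕28 · discharged 1∕28 unchanged); finite lattices only — NOT a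
continuum limit, NOT ℝ⁴, NOT OS, NOT a mass gap, NOT Clay.
-/

noncomputable section

namespace Summit.QuantumFields.YangMills.BalabanUVNodes.N15.RiemannKernel

open Finset
open Literature.Probability.LatticeModels (Site)
open Literature.MathematicalPhysics.QuantumLattice (blockMap blockSites mem_blockSites_iff card_blockSites)

variable {d : ℕ}

/-! ## §1. Block remainders: `x − M·⌊x∕M⌋ ∈ {0, …, M−1}^d` -/

/-- The block remainder of a site lies in `[0, M−1]` coordinatewise (`blockMap` is floor division, `M ≥ 1`). [folklore] -/
theorem sub_mul_blockMap_mem (M : ℕ) [NeZero M] (x : Site d) (i : Fin d) :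
    0 ≤ x i - (M : ℤ) * blockMap M x i ∧ x i - (M : ℤ) * blockMap M x i ≤ (M : ℤ) - 1 := by
  have hM : (0 : ℤ) < M := by exact_mod_cast Nat.pos_of_ne_zero (NeZero.ne M)
  have hrem : x i - (M : ℤ) * blockMap M x i = x i % (M : ℤ) := by
    rw [Int.emod_def]
    rfl
  rw [hrem]
  exact ⟨Int.emod_nonneg _ hM.ne', by have := Int.emod_lt_of_pos (x i) hM; omega⟩

/-- A site of the block of `u` has `u` as its block: `blockMap M u′ = u` (`mem_blockSites_iff`). [folklore] -/
theorem blockMap_eq_of_mem_blockSites {M : ℕ} [NeZero M] {u u' : Site d} (hu' : u' ∈ blockSites M u) :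
    blockMap M u' = u :=
  (mem_blockSites_iff M u u').1 hu'

/-- **The fine argument minus the coarse argument**: for `u′` in the block of `u` and `η = M·η′`,
`η′·(x′ − u′) − η·(⌊x′∕M⌋ − u) = η′·(r(x′) − r(u′))` with the block remainders `r`, hence sup norm `≤ η′·(M − 1)`. [folklore] -/
theorem norm_fineArg_sub_coarseArg_le (M : ℕ) [NeZero M] {η' : ℝ} (hη' : 0 ≤ η') (x' : Site d) {u u' : Site d}
    (hu' : u' ∈ blockSites M u) :
    ‖η' • (fun i => ((x' - u') i : ℝ)) - ((M : ℝ) * η') • (fun i => ((blockMap M x' - u) i : ℝ))‖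
      ≤ η' * ((M : ℝ) - 1) := by
  have hM1 : (1 : ℝ) ≤ M := by exact_mod_cast Nat.pos_of_ne_zero (NeZero.ne M)
  have hbound : 0 ≤ η' * ((M : ℝ) - 1) := mul_nonneg hη' (by linarith)
  refine (pi_norm_le_iff_of_nonneg hbound).2 fun i => ?_
  have hu : blockMap M u' = u := blockMap_eq_of_mem_blockSites hu'
  obtain ⟨hx0, hx1⟩ := sub_mul_blockMap_mem M x' i
  obtain ⟨hu0, hu1⟩ := sub_mul_blockMap_mem M u' i
  rw [hu] at hu0 hu1
  -- the coordinate is η′·(r(x′) − r(u′))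
  have hcoord : (η' • (fun i => ((x' - u') i : ℝ)) - ((M : ℝ) * η') • (fun i => ((blockMap M x' - u) i : ℝ))) i
      = η' * (((x' i - (M : ℤ) * blockMap M x' i : ℤ) : ℝ) - ((u' i - (M : ℤ) * u i : ℤ) : ℝ)) := by
    simp only [Pi.sub_apply, Pi.smul_apply, smul_eq_mul]
    push_cast
    ring
  rw [Real.norm_eq_abs, hcoord, abs_mul, abs_of_nonneg hη']
  refine mul_le_mul_of_nonneg_left ?_ hη'
  have h1 : ((x' i - (M : ℤ) * blockMap M x' i : ℤ) : ℝ) ≤ (M : ℝ) - 1 := by exact_mod_cast hx1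
  have h2 : (0 : ℝ) ≤ ((x' i - (M : ℤ) * blockMap M x' i : ℤ) : ℝ) := by exact_mod_cast hx0
  have h3 : ((u' i - (M : ℤ) * u i : ℤ) : ℝ) ≤ (M : ℝ) - 1 := by exact_mod_cast hu1
  have h4 : (0 : ℝ) ≤ ((u' i - (M : ℤ) * u i : ℤ) : ℝ) := by exact_mod_cast hu0
  rw [abs_le]
  constructor <;> linarith

/-! ## §2. The block Riemann sum of the fine kernel against the coarse kernel -/

/-- The coarse weight as a block sum of the fine weights: `η^d·c = Σ_{u′ ∈ B(u)} η′^d·c` for `η = M·η′` (the block has `M^d`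
sites, `card_blockSites`). [folklore] -/
theorem coarse_weight_eq_sum (M : ℕ) (η' : ℝ) (u : Site d) (c : ℝ) :
    ((M : ℝ) * η') ^ d * c = ∑ _u' ∈ blockSites M u, η' ^ d * c := by
  rw [sum_const, card_blockSites, nsmul_eq_mul, mul_pow]
  push_cast
  ring

/-- **THE BLOCK RIEMANN SUM OF A DISCRETISED LIPSCHITZ KERNEL** (the `U ≡ 1` input of the background step for kernel operators,
model form; owner's cut [DAGN15B-G0-CUT-1]): for `k` with `|k a − k b| ≤ Lip·‖a − b‖` (sup norm, `Lip ≥ 0`), `η′ ≥ 0`, `M ≥ 1` and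
`η = M·η′`, at every fine site `x′` and coarse site `u`, with `K′(x′,u′) = η′^d·k(η′·(x′ − u′))` and `K(x,u) = η^d·k(η·(x − u))`:
`|Σ_{u′ ∈ B(u)} K′(x′,u′) − K(⌊x′∕M⌋, u)| ≤ Lip·η^d·η′·(M − 1)`. [folklore] -/
theorem abs_blockSum_fineKernel_sub_coarseKernel_le (k : (Fin d → ℝ) → ℝ) {Lip : ℝ} (hLip : 0 ≤ Lip)
    (hk : ∀ a b, |k a - k b| ≤ Lip * ‖a - b‖) (M : ℕ) [NeZero M] {η' : ℝ} (hη' : 0 ≤ η') (x' u : Site d) :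
    |(∑ u' ∈ blockSites M u, η' ^ d * k (η' • fun i => ((x' - u') i : ℝ))) -
        ((M : ℝ) * η') ^ d * k (((M : ℝ) * η') • fun i => ((blockMap M x' - u) i : ℝ))|
      ≤ Lip * ((M : ℝ) * η') ^ d * (η' * ((M : ℝ) - 1)) := by
  rw [coarse_weight_eq_sum M η' u, ← sum_sub_distrib]
  have hη'd : 0 ≤ η' ^ d := pow_nonneg hη' d
  have hterm : ∀ u' ∈ blockSites M u,
      |η' ^ d * k (η' • fun i => ((x' - u') i : ℝ)) -
          η' ^ d * k (((M : ℝ) * η') • fun i => ((blockMap M x' - u) i : ℝ))|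
        ≤ η' ^ d * (Lip * (η' * ((M : ℝ) - 1))) := by
    intro u' hu'
    rw [← mul_sub, abs_mul, abs_of_nonneg hη'd]
    refine mul_le_mul_of_nonneg_left ?_ hη'd
    exact (hk _ _).trans (mul_le_mul_of_nonneg_left (norm_fineArg_sub_coarseArg_le M hη' x' hu') hLip)
  calc |∑ u' ∈ blockSites M u, (η' ^ d * k (η' • fun i => ((x' - u') i : ℝ)) -
          η' ^ d * k (((M : ℝ) * η') • fun i => ((blockMap M x' - u) i : ℝ)))|
      ≤ ∑ u' ∈ blockSites M u, |η' ^ d * k (η' • fun i => ((x' - u') i : ℝ)) -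
          η' ^ d * k (((M : ℝ) * η') • fun i => ((blockMap M x' - u) i : ℝ))| := abs_sum_le_sum_abs _ _
    _ ≤ ∑ _u' ∈ blockSites M u, η' ^ d * (Lip * (η' * ((M : ℝ) - 1))) := sum_le_sum hterm
    _ = Lip * ((M : ℝ) * η') ^ d * (η' * ((M : ℝ) - 1)) := by
        rw [sum_const, card_blockSites, nsmul_eq_mul, mul_pow]
        push_cast
        ring

/-- **The same with the coarse spacing only**: `… ≤ Lip·η^{d+1}`, `η = M·η′` (since `η′(M − 1) ≤ η`) — the size «(3∕2)·Lip·η²» of the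
owner's `d = 1` interface with constant `1`; against `sup|k|·η^d` the relative size is ONE rate factor `η·Lip∕sup|k|`. [folklore] -/
theorem abs_blockSum_fineKernel_sub_coarseKernel_le_pow (k : (Fin d → ℝ) → ℝ) {Lip : ℝ} (hLip : 0 ≤ Lip)
    (hk : ∀ a b, |k a - k b| ≤ Lip * ‖a - b‖) (M : ℕ) [NeZero M] {η' : ℝ} (hη' : 0 ≤ η') (x' u : Site d) :
    |(∑ u' ∈ blockSites M u, η' ^ d * k (η' • fun i => ((x' - u') i : ℝ))) -
        ((M : ℝ) * η') ^ d * k (((M : ℝ) * η') • fun i => ((blockMap M x' - u) i : ℝ))|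
      ≤ Lip * ((M : ℝ) * η') ^ (d + 1) := by
  refine (abs_blockSum_fineKernel_sub_coarseKernel_le k hLip hk M hη' x' u).trans ?_
  have hM0 : (0 : ℝ) ≤ M := Nat.cast_nonneg M
  have hle : η' * ((M : ℝ) - 1) ≤ (M : ℝ) * η' := by nlinarith
  have hpos : 0 ≤ Lip * ((M : ℝ) * η') ^ d := mul_nonneg hLip (pow_nonneg (mul_nonneg hM0 hη') d)
  calc Lip * ((M : ℝ) * η') ^ d * (η' * ((M : ℝ) - 1)) ≤ Lip * ((M : ℝ) * η') ^ d * ((M : ℝ) * η') :=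
        mul_le_mul_of_nonneg_left hle hpos
    _ = Lip * ((M : ℝ) * η') ^ (d + 1) := by rw [pow_succ]; ring

/-- The coarse-spacing letter: with `η = M·η′` GIVEN as a letter (`hη : η = M·η′`), the statement reads
`|Σ_{u′ ∈ B(u)} η′^d·k(η′(x′ − u′)) − η^d·k(η(⌊x′∕M⌋ − u))| ≤ Lip·η^{d+1}` — the shape «block-summed fine kernel minus coarse kernel,
uniformly in the two sites» that a kernel-operator binder consumes. [folklore] -/
theorem abs_blockSum_fineKernel_sub_coarseKernel_le_eta (k : (Fin d → ℝ) → ℝ) {Lip : ℝ} (hLip : 0 ≤ Lip)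
    (hk : ∀ a b, |k a - k b| ≤ Lip * ‖a - b‖) (M : ℕ) [NeZero M] {η' η : ℝ} (hη' : 0 ≤ η') (hη : η = (M : ℝ) * η')
    (x' u : Site d) :
    |(∑ u' ∈ blockSites M u, η' ^ d * k (η' • fun i => ((x' - u') i : ℝ))) -
        η ^ d * k (η • fun i => ((blockMap M x' - u) i : ℝ))| ≤ Lip * η ^ (d + 1) := by
  subst hη
  exact abs_blockSum_fineKernel_sub_coarseKernel_le_pow k hLip hk M hη' x' u

/-- **The owner's `d = 1` display** («K′(x′,u′) := η′·k(η′·(x′ − u′)) on ℤ, K(x,u) := η·k(η·(x − u))», [DAGN15B-G0-CUT-1]) for a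
scalar kernel `k : ℝ → ℝ` with `|k a − k b| ≤ Lip·|a − b|`, on the sites `Site 1 = (Fin 1 → ℤ)` of the prelude:
`|Σ_{u′ ∈ B(u)} η′·k(η′(x′₀ − u′₀)) − η·k(η(⌊x′∕M⌋₀ − u₀))| ≤ Lip·η²`, `η = M·η′` (constant `1 ≤ 3∕2`). [folklore] -/
theorem abs_blockSum_fineKernel_sub_coarseKernel_le_dim_one (k : ℝ → ℝ) {Lip : ℝ} (hLip : 0 ≤ Lip)
    (hk : ∀ a b, |k a - k b| ≤ Lip * |a - b|) (M : ℕ) [NeZero M] {η' : ℝ} (hη' : 0 ≤ η') (x' u : Site 1) :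
    |(∑ u' ∈ blockSites M u, η' * k (η' * ((x' - u') 0 : ℝ))) -
        ((M : ℝ) * η') * k (((M : ℝ) * η') * ((blockMap M x' - u) 0 : ℝ))| ≤ Lip * ((M : ℝ) * η') ^ 2 := by
  -- the scalar kernel read through the coordinate `0` is Lipschitz for the sup norm with the same constant
  have hk' : ∀ a b : Fin 1 → ℝ, |k (a 0) - k (b 0)| ≤ Lip * ‖a - b‖ := by
    intro a b
    refine (hk (a 0) (b 0)).trans (mul_le_mul_of_nonneg_left ?_ hLip)
    have h := norm_le_pi_norm (a - b) 0
    rwa [Pi.sub_apply, Real.norm_eq_abs] at h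
  have h := abs_blockSum_fineKernel_sub_coarseKernel_le_pow (d := 1) (fun v => k (v 0)) hLip hk' M hη' x' u
  simpa only [pow_one, Pi.smul_apply, smul_eq_mul] using h

/-- **Operator form on finitely supported functions**: for `f` on the coarse lattice and a finite set `S` of coarse sites,
`|Σ_{u∈S} Σ_{u′∈B(u)} K′(x′,u′)·f(u) − Σ_{u∈S} K(⌊x′∕M⌋,u)·f(u)| ≤ Lip·η^{d+1}·Σ_{u∈S}|f(u)|` — the pulled-back function `f∘π` is
constant on blocks, so the fine operator applied to it, minus the coarse operator read at `π x′`, is controlled in `ℓ¹(f)` by the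
pointwise kernel bound. [folklore] -/
theorem abs_blockSum_operator_defect_le (k : (Fin d → ℝ) → ℝ) {Lip : ℝ} (hLip : 0 ≤ Lip)
    (hk : ∀ a b, |k a - k b| ≤ Lip * ‖a - b‖) (M : ℕ) [NeZero M] {η' : ℝ} (hη' : 0 ≤ η') (x' : Site d)
    (S : Finset (Site d)) (f : Site d → ℝ) :
    |(∑ u ∈ S, (∑ u' ∈ blockSites M u, η' ^ d * k (η' • fun i => ((x' - u') i : ℝ))) * f u) -
        ∑ u ∈ S, ((M : ℝ) * η') ^ d * k (((M : ℝ) * η') • fun i => ((blockMap M x' - u) i : ℝ)) * f u|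
      ≤ Lip * ((M : ℝ) * η') ^ (d + 1) * ∑ u ∈ S, |f u| := by
  rw [← sum_sub_distrib, mul_sum]
  refine (abs_sum_le_sum_abs _ _).trans (sum_le_sum fun u _ => ?_)
  rw [← sub_mul, abs_mul]
  exact mul_le_mul_of_nonneg_right (abs_blockSum_fineKernel_sub_coarseKernel_le_pow k hLip hk M hη' x' u) (abs_nonneg _)

/-! ## §3. Sanity: the hypotheses are inhabited (the sup norm is `1`-Lipschitz) and the weight bookkeeping is exact
(a constant kernel has defect `0`) -/

/-- Non-vacuity of the hypotheses: the sup-norm itself is `1`-Lipschitz, so the theorem applies to `k = ‖·‖` with `Lip = 1`.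
[folklore] -/
theorem lipschitz_norm_example : ∀ a b : Fin d → ℝ, |‖a‖ - ‖b‖| ≤ 1 * ‖a - b‖ := by
  intro a b
  rw [one_mul]
  exact abs_norm_sub_norm_le a b

/-- For a CONSTANT kernel the block Riemann sum is exact (defect `0`): the weight bookkeeping `M^d η′^d = η^d` alone. [folklore] -/
theorem blockSum_const_kernel (M : ℕ) (η' c : ℝ) (x' u : Site d) :
    (∑ u' ∈ blockSites M u, η' ^ d * (fun _ : Fin d → ℝ => c) (η' • fun i => ((x' - u') i : ℝ))) =
      ((M : ℝ) * η') ^ d * (fun _ : Fin d → ℝ => c) (((M : ℝ) * η') • fun i => ((blockMap M x' - u) i : ℝ)) :=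
  (coarse_weight_eq_sum M η' u c).symm

end Summit.QuantumFields.YangMills.BalabanUVNodes.N15.RiemannKernel

end
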